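import Summits.ResolutionOfSingularities.ResolutionOfSingularities.Theorems.HomologicalConductorNoZenoRLipman41OfNormalStages
import Literature.AlgebraicGeometry.Resolution.BlowupsFlatBaseChange
import HarnessLib

/-!
# Crux `NoZenoR` (stmt-ResolutionOfSingularities-19943) — the stage-normality hypothesis of Lipman's (4.1) process IS
# Lipman's Proposition (8.1) «the quadratic transform of a rational singularity is normal»

Route `ResolutionOfSingularities/HomologicalConductor` (cell decomp-res, hand leafhand-res-homologicalconduct-21 g0).
OURS: AI-written proof over tree theorems, weaker than expert review; nothing here is a statement of the manuscript
under review (Hironaka 2017).  SUPPORT level, counted 0.  Def-free; no named fact assumed — the theorems are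
CONDITIONAL on the explicit hypothesis `H81` = Lipman Prop. (8.1) in its printed local form.

`…NoZenoRMinimalResolutionOfNormalStages` / `…NoZenoRLipman41OfNormalStages` run Lipman's process under the hypothesis
«every blowing up of a normal stage at a non-regular closed point has integrally closed local rings».  Here that
hypothesis is REDUCED to the printed statement of Proposition (8.1) (p. 212: "Let `Y` be a normal surface having only
rational singularities, and let `h : Y′ → Y` be a quadratic transformation. Then `Y′` is a normal surface"), read for
the LOCAL RING of the blown-up point:

  `H81` : for every two-dimensional normal Noetherian local domain `R` with a rational singularity, the quadratic
  transform `Bl_𝔪(Spec R) = affineBlowup 𝔪` has integrally closed local rings.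

* `ringKrullDim_stalk_eq_two_of_not_isRegularLocalRing` — a non-regular normal point of a stage has a two-dimensional
  local ring;
* `comap_fromSpecStalk_vanishingIdeal` — `𝓘_w·𝒪_{Spec 𝒪_{W,w}} = 𝔪̃_w` (Temkin 2.1.1 + `eq_vanishingIdeal_of_comap_fromSpecStalk_eq`);
* **`normalStages_of_quadraticNormal`** — `H81` implies the stage hypothesis: off the fibre the blow-up `b : W₂ → W` is a
  local isomorphism (`IsBlowup.isIso_compl`); over `w` the base change `W₂ ×_W Spec 𝒪_{W,w}` is THE quadratic transform
  of the rational (Prop. (1.2) 1)) normal two-dimensional `𝒪_{W,w}` (flat base change + uniqueness of blow-ups), whose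
  local rings are those of `W₂` at the points over `w` (pro-open immersion);
* **`exists_isMinimalResolution_isBlowup_of_quadraticNormal`**, **`Lipman1969_4_1_of_quadraticNormal`** — hence the local
  Theorem (4.1) (minimal desingularization of a rational `Spec S`, a blow-up of an `𝔪`-primary centre) and the W3 print
  `Lipman1969_4_1.{0}` follow from `H81` ALONE: `Lipman1969_4_1 ⟸ Prop. (8.1)`, with no contraction theorem (27.1).

Prop. (8.1) itself (complete ideals, §§5–8) is NOT proved here.  No crux, kill test or summit statement is proved here;
resolution in positive characteristic is NOT proved.

References: J. Lipman, Publ. Math. IHÉS 36 (1969), Proposition (8.1) (p. 212), Theorem (4.1) (p. 204), Prop. (1.2) (p. 199)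
[`Lipman1969`]; M. Temkin, Adv. Math. 219 (2008), §2.1 [`Temkin2008`]; U. Görtz, T. Wedhorn, *Algebraic Geometry I*
(2020), Prop. 13.91 [`GortzWedhorn2020`].
-/

noncomputable section

-- single-problem summit: the doubled namespace component `ResolutionOfSingularities` is forced
set_option linter.dupNamespace false

open CategoryTheory CategoryTheory.Limits AlgebraicGeometry TopologicalSpace Topology IsLocalRing
open Literature.AlgebraicGeometry.Resolution

namespace Summit.ResolutionOfSingularities.ResolutionOfSingularities.Theorems.NoZeno.QuadraticTransform

variable {S : Type} [CommRing S] [IsNoetherianRing S] [IsLocalRing S] [IsDomain S] [IsIntegrallyClosed S]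

omit [IsLocalRing S] [IsDomain S] [IsIntegrallyClosed S] in
/-- A non-regular NORMAL point of a stage (integral Noetherian, birational of finite type over the two-dimensional `S`)
has a local ring of dimension exactly `2` (normal of dimension `≤ 1` would be regular). [cite: Matsumura1987, Thm. 11.2] -/
theorem ringKrullDim_stalk_eq_two_of_not_isRegularLocalRing (hdim : ringKrullDim S = 2) {W : Scheme.{0}}
    [IsIntegral W] [IsNoetherian W] (g : W ⟶ Spec (.of S)) [LocallyOfFiniteType g] (hg : IsBirational g) {w : W}
    (hw : IsIntegrallyClosed (W.presheaf.stalk w)) (hwsing : ¬ IsRegularLocalRing (W.presheaf.stalk w)) :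
    ringKrullDim (W.presheaf.stalk w) = 2 := by
  haveI := hw
  refine le_antisymm (ringKrullDim_stalk_le_two_of_isBirational hdim.le g hg w) ?_
  by_contra hlt
  apply hwsing
  apply isRegularLocalRing_of_isIntegrallyClosed_of_ringKrullDim_le_one
  rw [ringKrullDim_stalk_eq_coheight] at hlt ⊢
  have h1 : Order.coheight w < 2 := by
    by_contra h2
    apply hlt
    have h3 : (2 : ℕ∞) ≤ Order.coheight w := not_lt.mp h2
    have h4 : ((2 : ℕ∞) : WithBot ℕ∞) ≤ ((Order.coheight w : ℕ∞) : WithBot ℕ∞) := WithBot.coe_le_coe.mpr h3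
    exact le_trans (by norm_cast) h4
  obtain ⟨m, hm⟩ := ENat.ne_top_iff_exists.mp h1.ne_top
  rw [← hm] at h1 ⊢
  have h3 : m < 2 := by exact_mod_cast h1
  have h4 : m ≤ 1 := by omega
  exact_mod_cast h4

/-- **`𝓘_w·𝒪_{Spec 𝒪_{W,w}} = 𝔪̃_w`**: the ideal of the reduced closed point `w` restricts along `Spec 𝒪_{W,w} → W` to the ideal
sheaf of the maximal ideal. [cite: Temkin2008, Lemma 2.1.1] -/
theorem comap_fromSpecStalk_vanishingIdeal {W : Scheme.{0}} [IsLocallyNoetherian W] (w : W) (hwc : IsClosed ({w} : Set W)) :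
    (Scheme.IdealSheafData.vanishingIdeal ⟨{w}, hwc⟩).comap (W.fromSpecStalk w) =
      affineBlowup.idealSheaf (maximalIdeal (W.presheaf.stalk w)) := by
  obtain ⟨J, hJ, hJsupp⟩ := GlobalResolution.exists_comap_fromSpecStalk_eq w hwc
    (affineBlowup.idealSheaf (maximalIdeal (W.presheaf.stalk w))) (support_affineBlowupIdealSheaf_maximalIdeal_subset w)
  rw [← eq_vanishingIdeal_of_comap_fromSpecStalk_eq w hwc hJsupp hJ]
  exact hJ

/-- **Prop. (8.1) (quadratic transforms of rational singularities are normal) implies the normality of all stages of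
Lipman's process.**  See the module docstring. [cite: Lipman1969, Proposition (8.1) (p. 212); Theorem (4.1), proof (p. 204)] -/
theorem normalStages_of_quadraticNormal
    (H81 : ∀ (R : Type) [CommRing R] [IsNoetherianRing R] [IsLocalRing R] [IsDomain R] [IsIntegrallyClosed R],
      ringKrullDim R = 2 → HasRationalSingularity R →
      ∀ y : affineBlowup (maximalIdeal R), IsIntegrallyClosed ((affineBlowup (maximalIdeal R)).presheaf.stalk y))
    (hdim : ringKrullDim S = 2) (hrat : HasRationalSingularity S) :
    ∀ (W W₂ : Scheme.{0}) (_ : IsIntegral W) (_ : IsNoetherian W) (g : W ⟶ Spec (.of S)) (_ : IsProper g),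
      IsBirational g → (∀ y : W, IsIntegrallyClosed (W.presheaf.stalk y)) →
      ∀ (w : W) (hwc : IsClosed ({w} : Set W)), ¬ IsRegularLocalRing (W.presheaf.stalk w) →
      ∀ (b : W₂ ⟶ W), IsBlowup b (Scheme.IdealSheafData.vanishingIdeal ⟨{w}, hwc⟩) →
      ∀ y : W₂, IsIntegrallyClosed (W₂.presheaf.stalk y) := by
  intro W W₂ _ _ g _ hg hWn w hwc hwsing b hb y
  by_cases hy : b y = w
  · -- over `w`: the base change to `Spec 𝒪_{W,w}` is the quadratic transform of the rational normal `𝒪_{W,w}`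
    haveI := hWn w
    have hw2 := ringKrullDim_stalk_eq_two_of_not_isRegularLocalRing hdim g hg (hWn w) hwsing
    have hwrat : HasRationalSingularity (W.presheaf.stalk w) := hasRationalSingularity_stalk_of_stage g hdim hrat hg w (hWn w) hw2
    haveI := flat_fromSpecStalk W w
    have hbι : IsBlowup (pullback.snd b (W.fromSpecStalk w))
        (affineBlowup.idealSheaf (maximalIdeal (W.presheaf.stalk w))) := by
      have h := hb.pullback_snd_of_flat (W.fromSpecStalk w)
      rw [comap_fromSpecStalk_vanishingIdeal w hwc] at h
      exact h
    obtain ⟨e, -, -⟩ := hbι.unique (affineBlowup.isBlowup (maximalIdeal (W.presheaf.stalk w)))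
    -- the point of the base change over `y`, with isomorphic local rings
    obtain ⟨s, hs⟩ := mem_range_pullback_fst_fromSpecStalk_of_eq b w (x' := y) hy
    haveI := isIso_stalkMap_pullback_fst_fromSpecStalk b w s
    haveI : IsIntegrallyClosed ((affineBlowup (maximalIdeal (W.presheaf.stalk w))).presheaf.stalk (e.hom s)) :=
      H81 (W.presheaf.stalk w) hw2 hwrat (e.hom s)
    haveI : IsIntegrallyClosed ((pullback b (W.fromSpecStalk w)).presheaf.stalk s) :=
      IsIntegrallyClosed.of_equiv (asIso (e.hom.stalkMap s)).commRingCatIsoToRingEquiv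
    rw [← hs]
    exact IsIntegrallyClosed.of_equiv (asIso ((pullback.fst b (W.fromSpecStalk w)).stalkMap s)).commRingCatIsoToRingEquiv.symm
  · -- off `w`: `b` is an isomorphism near `y`
    haveI := hb.isIso_compl
    have hyU : b y ∈ (⟨((Scheme.IdealSheafData.vanishingIdeal (X := W) ⟨{w}, hwc⟩).support : Set W)ᶜ,
        (Scheme.IdealSheafData.vanishingIdeal (X := W) ⟨{w}, hwc⟩).support.isClosed.isOpen_compl⟩ : W.Opens) := by
      change b y ∈ ((Scheme.IdealSheafData.vanishingIdeal (X := W) ⟨{w}, hwc⟩).support : Set W)ᶜ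
      rw [Scheme.IdealSheafData.coe_support_vanishingIdeal]
      exact hy
    haveI := isIso_stalkMap_of_isIso_morphismRestrict b _ y hyU
    haveI := hWn (b y)
    exact IsIntegrallyClosed.of_equiv (asIso (b.stalkMap y)).commRingCatIsoToRingEquiv

/-- **The local Theorem (4.1) from Prop. (8.1) alone**: a two-dimensional normal Noetherian local domain with a rational
singularity has a MINIMAL desingularization of `Spec S`, which is a blowing up along a centre cosupported at the closed
point. [cite: Lipman1969, Theorem (4.1) (p. 204); Proposition (8.1) (p. 212)] -/
theorem exists_isMinimalResolution_isBlowup_of_quadraticNormal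
    (H81 : ∀ (R : Type) [CommRing R] [IsNoetherianRing R] [IsLocalRing R] [IsDomain R] [IsIntegrallyClosed R],
      ringKrullDim R = 2 → HasRationalSingularity R →
      ∀ y : affineBlowup (maximalIdeal R), IsIntegrallyClosed ((affineBlowup (maximalIdeal R)).presheaf.stalk y))
    (hdim : ringKrullDim S = 2) (hrat : HasRationalSingularity S) :
    ∃ (X₀ : Scheme.{0}) (f : X₀ ⟶ Spec (.of S)) (J : (Spec (.of S)).IdealSheafData),
      IsMinimalResolution f ∧ IsBlowup f J ∧ (J.support : Set (Spec (.of S))) ⊆ {closedPoint S} :=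
  exists_isMinimalResolution_isBlowup_of_normalStages hdim hrat (normalStages_of_quadraticNormal H81 hdim hrat)

/-- **`Lipman1969_4_1 ⟸ Prop. (8.1)`** (no (27.1)). [cite: Lipman1969, Theorem (4.1) (p. 204); Proposition (8.1) (p. 212)] -/
theorem Lipman1969_4_1_of_quadraticNormal
    (H81 : ∀ (R : Type) [CommRing R] [IsNoetherianRing R] [IsLocalRing R] [IsDomain R] [IsIntegrallyClosed R],
      ringKrullDim R = 2 → HasRationalSingularity R →
      ∀ y : affineBlowup (maximalIdeal R), IsIntegrallyClosed ((affineBlowup (maximalIdeal R)).presheaf.stalk y)) :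
    Lipman1969_4_1.{0} :=
  Lipman1969_4_1_of_normalStages fun _ _ _ _ _ _ h2 hS => normalStages_of_quadraticNormal H81 h2 hS

end Summit.ResolutionOfSingularities.ResolutionOfSingularities.Theorems.NoZeno.QuadraticTransform

end
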